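import Literature.Analysis.FluidPDE.CriticalSpaces
import HarnessLib

/-!
# Proofs for `CriticalSpaces.lean`: `L^p ⊂ 𝓢'` and the scale invariance of `BMO⁻¹`

Sibling proof file of `Literature/Analysis/FluidPDE/CriticalSpaces.lean`, discharging the named
facts `Literature.Analysis.FluidPDE.exists_isDistributionOf_of_memLp_three` (`L³(ℝ³) ⊂ 𝓢'(ℝ³)`: an `L³` vector field
`u₀ : ℝ³ → ℝ³` has a tempered distribution `U` with `U φ = ∫ φ • complexify ∘ u₀`, i.e.
`Literature.NS.IsDistributionOf u₀ U`) and `Literature.Analysis.FluidPDE.eBMOInvNorm_rescaleData`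
(`BMO⁻¹(ℝ³)` is critical: the `BMO⁻¹` norm of every component is invariant under the
Navier–Stokes scaling of data `u₀ ↦ c u₀(c ·)`, `c > 0`; second part of this file). Everything
here is proved; no new named fact is introduced.

## Part 1: `L^p ⊂ 𝓢'`

The printed source is the standard example "every `L^p` function, `1 ≤ p ≤ ∞`, is a tempered
distribution" of Bahouri–Chemin–Danchin, *Fourier Analysis and Nonlinear PDE* (2011), §1.2
(tempered distributions), which Mathlib implements as `MeasureTheory.Lp.toTemperedDistribution`
(`Mathlib/Analysis/Distribution/TemperedDistribution.lean`). The proof below is that example,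
for vector fields and in the generality Mathlib's embedding allows:

* `Literature.Analysis.FluidPDE.memLp_complexify_comp` — `complexify` is an isometry `ℝ^ι →ₗᵢ[ℝ] ℂ^ι`, so
  `u₀ ∈ L^p ↔ complexify ∘ u₀ ∈ L^p`;
* `Literature.Analysis.FluidPDE.isDistributionOf_toTemperedDistribution` — for `1 ≤ p` and `u₀ ∈ L^p(E; ℝ^ι)` on any
  real normed space `E` whose volume has temperate growth, the Mathlib distribution of the class
  `[complexify ∘ u₀] ∈ L^p` *is* the distribution of `u₀`: its action on a Schwartz `φ` is
  `∫ φ • [complexify ∘ u₀]` (`Lp.toTemperedDistribution_apply`), equal to `∫ φ • complexify ∘ u₀`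
  because the `L^p` representative agrees a.e. with the function (`MemLp.coeFn_toLp`), and
  `φ • complexify ∘ u₀ ∈ L¹` by Hölder (`MemLp.smul`) with `φ ∈ L^{p'}`,
  `p' = ENNReal.conjExponent p` (`SchwartzMap.memLp`);
* `Literature.Analysis.FluidPDE.exists_isDistributionOf_of_memLp` — the existence corollary for every `1 ≤ p`;
* `Literature.Analysis.FluidPDE.exists_isDistributionOf_of_memLp_three_holds` — the named fact, `p = 3` on `ℝ³`.

## Part 2: scale invariance of `BMO⁻¹` (discharge of `eBMOInvNorm_rescaleData`)

Source: H. Koch, D. Tataru, *Well-posedness for the Navier–Stokes equations*, Adv. Math. 157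
(2001), §1 (p. 2 of the held copy `paper:doi-10-1006-aima-2000-1937`): "The Navier–Stokes
equations are invariant with respect to scaling (here one considers `u` as velocity). Hence we
want a scale and translation invariant version of `L²`-boundedness", which leads to the
definition of `BMO⁻¹`; Theorem 1 (p. 3 of the held copy) is the divergence characterisation
`u ∈ BMO⁻¹ ⟺ u = ∑ ∂ᵢ fⁱ`, `fⁱ ∈ BMO`, which this library takes as the definition
(`Literature.Analysis.FunctionSpaces.MemBMOInv`, `Literature.Analysis.FunctionSpaces.eBMOInvNorm`
`= inf_Φ sup_{‖v‖ ≤ 1} ‖⟪Φ, v⟫‖_*`). The paper prints no proof of the scale invariance (a change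
of variables); the Lean proof is that change of variables, for the divergence-form norm, on any
finite-dimensional real inner product space `E` and for every `c ≠ 0`:

* `Literature.Analysis.FluidPDE.map_smul_normalize_restrict_ball` — the dilation `y ↦ c y`
  pushes the normalised ball measure `|B(x,r)|⁻¹ μ|_{B(x,r)}` of a Haar measure `μ` to
  `|B(cx,‖c‖r)|⁻¹ μ|_{B(cx,‖c‖r)}` (`MeasureTheory.Measure.map_addHaar_smul`: the Jacobian
  `|c|^{-d}` cancels), whence ball averages (`⨍`, `⨍⁻`) of `f(c ·)` over `B(x,r)` are ball
  averages of `f` over `B(cx, ‖c‖r)` with no measurability or integrability hypothesis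
  (`MeasurableEmbedding.integral_map`, `MeasurableEmbedding.lintegral_map`), and
  `Literature.Analysis.FluidPDE.eBMOSeminorm_comp_smul`: `‖f(c ·)‖_* = ‖f‖_*` (Grafakos, *Modern
  Fourier Analysis*, Proposition 3.1.2 (6), held scan p. 201, proof p. 202:
  `Avg_Q δ^λ f = Avg_{λQ} f`; here with balls);
* `Literature.Analysis.FunctionSpaces.HasWeakDivergenceRepresentation.comp_smul` — if `u = div Φ`
  weakly then `c u(c ·) = div (Φ(c ·))` weakly: test against `φ` by testing `u` against the
  dilated test function `φ(c⁻¹ ·)` (`∇(φ(c⁻¹ ·)) = c⁻¹ (∇φ)(c⁻¹ ·)`) and change variables twice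
  (`MeasureTheory.Measure.integral_comp_smul`, `MeasureTheory.Measure.integral_comp_inv_smul`);
  local integrability dilates by `MeasureTheory.locallyIntegrable_map_homeomorph`;
* `Literature.Analysis.FluidPDE.eBMOInvNorm_comp_smul` — hence every representation of `u`
  yields one of `c u(c ·)` with the same vector `BMO` seminorm, `‖c u(c ·)‖_{BMO⁻¹} ≤ ‖u‖_{BMO⁻¹}`,
  and equality by applying this to `c⁻¹`;
* `Literature.Analysis.FluidPDE.eBMOInvNorm_rescaleData_holds` — the named fact on `ℝ³`, since
  `⟪c u₀(c x), v⟫ = c ⟪u₀(c x), v⟫`.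

Mathlib has no `BMO` (searched `BMO`, `mean oscillation`); the tree's dilation lemmas for ball
integrals (`Literature.Analysis.FluidPDE.setLIntegral_ball_center_comp_smul` in
`CriticalRegularityScaling`, `setAverage_ball_comp_space_affine` in `LocalTypeIScaling`) live
behind heavier imports (`CriticalRegularity`, the weak-solution layer) and are `ℝ≥0∞`- or
`ℝ³`/`ℝ`-valued only; the normalised-measure identity is re-proved here in a few lines for a
general Haar measure and Banach-valued `f`.

## References

* H. Bahouri, J.-Y. Chemin, R. Danchin, *Fourier Analysis and Nonlinear Partial Differential
  Equations*, Grundlehren 343, Springer (2011), §1.2 (tempered distributions; `L^p ⊂ 𝓢'`)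
  ("BCD").
* H. Koch, D. Tataru, *Well-posedness for the Navier–Stokes equations*, Adv. Math. 157 (2001)
  22–35, doi:10.1006/aima.2000.1937, §1 and Theorem 1. [KochTataru2001] = [KochTataruAdvMath2001]
  (held: `paper:doi-10-1006-aima-2000-1937`, pp. 2–3).
* L. Grafakos, *Modern Fourier Analysis*, 3rd ed., GTM 250, Springer (2014), Proposition 3.1.2
  (5)–(6) (translation and dilation invariance of `‖·‖_{BMO}`), held scan pp. 201–202.
  [GrafakosMFA2014]
-/

noncomputable section

open MeasureTheory TemperedDistribution Filter Topology
open scoped SchwartzMap ENNReal NNReal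

namespace Literature.Analysis.FluidPDE

/-! ## `L^p` fields and their Mathlib tempered distribution -/

section Complexify

variable {ι : Type*} [Fintype ι] {α : Type*} {m : MeasurableSpace α} {μ : Measure α}

/-- `complexify : ℝ^ι → ℂ^ι` is an isometry, so a field `u₀ : α → ℝ^ι` is in `L^p(μ)` iff its
complexification is (BCD §1.2; `Literature.Analysis.FunctionSpaces.EuclideanSpace.complexify`). [folklore] -/
theorem memLp_complexify_comp_iff {p : ℝ≥0∞} {u₀ : α → EuclideanSpace ℝ ι} :
    MemLp (fun x => FunctionSpaces.EuclideanSpace.complexify (u₀ x)) p μ ↔ MemLp u₀ p μ := by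
  have hmeas : AEStronglyMeasurable (fun x => FunctionSpaces.EuclideanSpace.complexify (u₀ x)) μ ↔
      AEStronglyMeasurable u₀ μ :=
    (FunctionSpaces.EuclideanSpace.complexify (ι := ι)).isometry.isEmbedding.aestronglyMeasurable_comp_iff
  have hnorm : ∀ x, ‖FunctionSpaces.EuclideanSpace.complexify (u₀ x)‖ = ‖u₀ x‖ := fun x =>
    FunctionSpaces.EuclideanSpace.norm_complexify (u₀ x)
  constructor
  · exact fun h => MemLp.of_le h (hmeas.1 h.aestronglyMeasurable)
      (Eventually.of_forall fun x => (hnorm x).ge)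
  · exact fun h => MemLp.of_le h (hmeas.2 h.aestronglyMeasurable)
      (Eventually.of_forall fun x => (hnorm x).le)

/-- An `L^p(μ)` field `u₀ : α → ℝ^ι` has `complexify ∘ u₀ ∈ L^p(μ; ℂ^ι)` (BCD §1.2). [folklore] -/
theorem memLp_complexify_comp {p : ℝ≥0∞} {u₀ : α → EuclideanSpace ℝ ι} (hu : MemLp u₀ p μ) :
    MemLp (fun x => FunctionSpaces.EuclideanSpace.complexify (u₀ x)) p μ :=
  memLp_complexify_comp_iff.2 hu

end Complexify

section General

variable {ι : Type*} [Fintype ι] {E : Type*} [NormedAddCommGroup E] [NormedSpace ℝ E]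
  [MeasureSpace E] [BorelSpace E] [(volume : Measure E).HasTemperateGrowth]

/-- **`L^p ⊂ 𝓢'`** (BCD §1.2, the example "every `L^p` function is a tempered distribution";
Mathlib `MeasureTheory.Lp.toTemperedDistribution`). For `1 ≤ p` and `u₀ ∈ L^p(E; ℝ^ι)`, the
Mathlib tempered distribution of the class `[complexify ∘ u₀] ∈ L^p` is the distribution of
`u₀` in the sense of `IsDistributionOf`: `φ • complexify ∘ u₀ ∈ L¹` for every Schwartz `φ`
(Hölder, `φ ∈ L^{p'}`) and `[complexify ∘ u₀] φ = ∫ φ • complexify ∘ u₀`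
(BCD §1.2). [cite: BahouriCheminDanchin2011, §1.2] -/
theorem isDistributionOf_toTemperedDistribution {p : ℝ≥0∞} [Fact (1 ≤ p)]
    {u₀ : E → EuclideanSpace ℝ ι} (hu : MemLp u₀ p volume) :
    IsDistributionOf u₀ (Lp.toTemperedDistribution ((memLp_complexify_comp hu).toLp _)) := by
  intro φ
  have hc : MemLp (fun x => FunctionSpaces.EuclideanSpace.complexify (u₀ x)) p (volume : Measure E) :=
    memLp_complexify_comp hu
  -- Hölder: `φ ∈ L^{p'}`, `complexify ∘ u₀ ∈ L^p`, so `φ • complexify ∘ u₀ ∈ L¹`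
  have hφ : MemLp (φ : E → ℂ) (ENNReal.conjExponent p) (volume : Measure E) := φ.memLp _ _
  have h1 : MemLp ((φ : E → ℂ) • fun x => FunctionSpaces.EuclideanSpace.complexify (u₀ x)) 1
      (volume : Measure E) :=
    hc.smul hφ
  refine ⟨memLp_one_iff_integrable.1 h1, ?_⟩
  rw [Lp.toTemperedDistribution_apply]
  refine integral_congr_ae ?_
  filter_upwards [hc.coeFn_toLp (μ := (volume : Measure E)) (p := p)] with x hx
  rw [hx]

/-- **`L^p ⊂ 𝓢'`**, existence form (BCD §1.2): for `1 ≤ p`, every `L^p` field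
`u₀ : E → ℝ^ι` has a tempered distribution `U` with `IsDistributionOf u₀ U` (unique by
`IsDistributionOf.unique`). [cite: BahouriCheminDanchin2011, §1.2] -/
theorem exists_isDistributionOf_of_memLp {p : ℝ≥0∞} [Fact (1 ≤ p)]
    {u₀ : E → EuclideanSpace ℝ ι} (hu : MemLp u₀ p volume) :
    ∃ U : 𝓢'(E, EuclideanSpace ℂ ι), IsDistributionOf u₀ U :=
  ⟨_, isDistributionOf_toTemperedDistribution hu⟩

end General

/-! ## Discharge of the named fact `exists_isDistributionOf_of_memLp_three` -/

/-- **Discharge** of the named fact `exists_isDistributionOf_of_memLp_three` of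
`CriticalSpaces.lean` (`L³(ℝ³) ⊂ 𝓢'(ℝ³)`; BCD §1.2, the example "every `L^p` function is a
tempered distribution", here `p = 3`, `d = 3`, vector-valued): the case `p = 3`,
`E = ℝ³` of `exists_isDistributionOf_of_memLp`, with the instance `Fact (1 ≤ 3)` supplied
(BCD §1.2). [cite: BahouriCheminDanchin2011, §1.2] -/
theorem exists_isDistributionOf_of_memLp_three_holds :
    exists_isDistributionOf_of_memLp_three := by
  intro u₀ hu
  haveI : Fact (1 ≤ (3 : ℝ≥0∞)) := ⟨by norm_num⟩
  exact exists_isDistributionOf_of_memLp hu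

/-! ## Part 2: dilation invariance of `BMO` and `BMO⁻¹`; discharge of `eBMOInvNorm_rescaleData` -/

open Metric TopologicalSpace
open scoped RealInnerProductSpace

section BMODilation

variable {E : Type*} [NormedAddCommGroup E] [NormedSpace ℝ E] [FiniteDimensional ℝ E]
  [MeasurableSpace E] [BorelSpace E] (μ : Measure E) [μ.IsAddHaarMeasure]
variable {F : Type*} [NormedAddCommGroup F] [NormedSpace ℝ F]

omit [FiniteDimensional ℝ E] [MeasurableSpace E] [BorelSpace E] in
/-- The dilation `y ↦ c • y`, `c ≠ 0`, pulls the ball `B(c • x, ‖c‖ r)` back to `B(x, r)`. [folklore] -/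
theorem preimage_smul_ball_smul {c : ℝ} (hc : c ≠ 0) (x : E) (r : ℝ) :
    (fun y : E => c • y) ⁻¹' ball (c • x) (‖c‖ * r) = ball x r := by
  ext y
  simp only [Set.mem_preimage, mem_ball, dist_smul₀]
  exact mul_lt_mul_iff_right₀ (norm_pos_iff.2 hc)

/-- **Normalised ball measures are dilation invariant**: the push-forward under `y ↦ c • y`
(`c ≠ 0`) of the probability measure `|B(x,r)|⁻¹ μ|_{B(x,r)}` of a Haar measure `μ` is
`|B(cx, ‖c‖r)|⁻¹ μ|_{B(cx, ‖c‖r)}` (the Jacobian `|c|^{-d}` of `MeasureTheory.Measure.map_addHaar_smul`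
cancels). [folklore] -/
theorem map_smul_normalize_restrict_ball {c : ℝ} (hc : c ≠ 0) (x : E) (r : ℝ) :
    Measure.map (fun y : E => c • y) ((μ (ball x r))⁻¹ • μ.restrict (ball x r)) =
      (μ (ball (c • x) (‖c‖ * r)))⁻¹ • μ.restrict (ball (c • x) (‖c‖ * r)) := by
  have hme : MeasurableEmbedding (fun y : E => c • y) :=
    (Homeomorph.smulOfNeZero c hc).measurableEmbedding
  have hk0 : ENNReal.ofReal |(c ^ Module.finrank ℝ E)⁻¹| ≠ 0 :=
    (ENNReal.ofReal_pos.2 (abs_pos.2 (inv_ne_zero (pow_ne_zero _ hc)))).ne'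
  have hkt : ENNReal.ofReal |(c ^ Module.finrank ℝ E)⁻¹| ≠ ∞ := ENNReal.ofReal_ne_top
  have hscal : (ENNReal.ofReal |(c ^ Module.finrank ℝ E)⁻¹| * μ (ball (c • x) (‖c‖ * r)))⁻¹ *
      ENNReal.ofReal |(c ^ Module.finrank ℝ E)⁻¹| = (μ (ball (c • x) (‖c‖ * r)))⁻¹ := by
    rw [ENNReal.mul_inv (Or.inl hk0) (Or.inl hkt), mul_right_comm,
      ENNReal.inv_mul_cancel hk0 hkt, one_mul]
  rw [Measure.map_smul, ← preimage_smul_ball_smul hc x r,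
    ← hme.restrict_map μ (ball (c • x) (‖c‖ * r)), Measure.map_addHaar_smul μ hc,
    Measure.restrict_smul, Measure.addHaar_preimage_smul μ hc, smul_smul, hscal]

/-- **Ball averages are dilation invariant**: `⨍_{B(x,r)} f(c y) dμ(y) = ⨍_{B(cx, ‖c‖r)} f dμ`
for a Haar measure `μ` and `c ≠ 0` (no integrability needed: both sides are junk together). [folklore] -/
theorem setAverage_ball_comp_smul (f : E → F) {c : ℝ} (hc : c ≠ 0) (x : E) (r : ℝ) :
    ⨍ y in ball x r, f (c • y) ∂μ = ⨍ y in ball (c • x) (‖c‖ * r), f y ∂μ := by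
  have hme : MeasurableEmbedding (fun y : E => c • y) :=
    (Homeomorph.smulOfNeZero c hc).measurableEmbedding
  rw [setAverage_eq', setAverage_eq', ← map_smul_normalize_restrict_ball μ hc x r,
    hme.integral_map]

/-- **Ball averages are dilation invariant**, `ℝ≥0∞`-valued form:
`⨍⁻_{B(x,r)} g(c y) dμ(y) = ⨍⁻_{B(cx, ‖c‖r)} g dμ` for a Haar measure `μ` and `c ≠ 0`. [folklore] -/
theorem setLAverage_ball_comp_smul (g : E → ℝ≥0∞) {c : ℝ} (hc : c ≠ 0) (x : E) (r : ℝ) :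
    ⨍⁻ y in ball x r, g (c • y) ∂μ = ⨍⁻ y in ball (c • x) (‖c‖ * r), g y ∂μ := by
  have hme : MeasurableEmbedding (fun y : E => c • y) :=
    (Homeomorph.smulOfNeZero c hc).measurableEmbedding
  rw [setLAverage_eq', setLAverage_eq', ← map_smul_normalize_restrict_ball μ hc x r,
    hme.lintegral_map]

/-- The mean oscillation of `f (c ·)` over `B(x, r)` is the mean oscillation of `f` over
`B(cx, ‖c‖ r)`, `c ≠ 0` (Grafakos, *Modern Fourier Analysis*, proof of Proposition 3.1.2 (6),
held scan p. 202: `Avg_Q δ^λ(f) = Avg_{λQ} f`; here with balls and a general Haar measure). [cite: GrafakosMFA2014, Proposition 3.1.2 (6)] -/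
theorem laverage_oscillation_comp_smul (f : E → F) {c : ℝ} (hc : c ≠ 0) (x : E) (r : ℝ) :
    ⨍⁻ y in ball x r, ‖f (c • y) - ⨍ z in ball x r, f (c • z) ∂μ‖ₑ ∂μ =
      ⨍⁻ y in ball (c • x) (‖c‖ * r), ‖f y - ⨍ z in ball (c • x) (‖c‖ * r), f z ∂μ‖ₑ ∂μ := by
  rw [setAverage_ball_comp_smul μ f hc x r]
  exact setLAverage_ball_comp_smul μ (fun y => ‖f y - ⨍ z in ball (c • x) (‖c‖ * r), f z ∂μ‖ₑ)
    hc x r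

/-- **Dilations do not increase the `BMO` seminorm**: `‖f (c ·)‖_* ≤ ‖f‖_*` for `c ≠ 0` and a Haar
measure: each ball oscillation of `f (c ·)` is a ball oscillation of `f` (Grafakos, *Modern
Fourier Analysis*, Proposition 3.1.2 (6), held scan pp. 201–202). [cite: GrafakosMFA2014, Proposition 3.1.2 (6)] -/
theorem eBMOSeminorm_comp_smul_le (f : E → F) {c : ℝ} (hc : c ≠ 0) :
    FunctionSpaces.eBMOSeminorm (fun y => f (c • y)) μ ≤ FunctionSpaces.eBMOSeminorm f μ := by
  refine iSup_le fun x => iSup₂_le fun r hr => ?_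
  calc ⨍⁻ y in ball x r, ‖f (c • y) - ⨍ z in ball x r, f (c • z) ∂μ‖ₑ ∂μ
      = ⨍⁻ y in ball (c • x) (‖c‖ * r), ‖f y - ⨍ z in ball (c • x) (‖c‖ * r), f z ∂μ‖ₑ ∂μ :=
        laverage_oscillation_comp_smul μ f hc x r
    _ ≤ FunctionSpaces.eBMOSeminorm f μ :=
        FunctionSpaces.laverage_oscillation_le_eBMOSeminorm f μ (c • x)
          (mul_pos (norm_pos_iff.2 hc) hr)

/-- **The `BMO` seminorm is dilation invariant**: `‖δ^c f‖_* = ‖f‖_*`, `δ^c f = f (c ·)`, for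
`c ≠ 0` and a Haar measure on a finite-dimensional real normed space (Grafakos, *Modern Fourier
Analysis*, Proposition 3.1.2 (6), held scan p. 201, stated there for `λ > 0` and cubes in `ℝⁿ`;
`c < 0` reduces to `c > 0` by the same change of variables). [cite: GrafakosMFA2014, Proposition 3.1.2 (6)] -/
theorem eBMOSeminorm_comp_smul (f : E → F) {c : ℝ} (hc : c ≠ 0) :
    FunctionSpaces.eBMOSeminorm (fun y => f (c • y)) μ = FunctionSpaces.eBMOSeminorm f μ := by
  refine le_antisymm (eBMOSeminorm_comp_smul_le μ f hc) ?_
  have h := eBMOSeminorm_comp_smul_le μ (fun y => f (c • y)) (inv_ne_zero hc)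
  simpa only [smul_smul, mul_inv_cancel₀ hc, one_smul] using h

/-- Local integrability is stable under a finite rescaling of the measure. [folklore] -/
theorem locallyIntegrable_smul_measure {X F' : Type*} [TopologicalSpace X] [MeasurableSpace X]
    [NormedAddCommGroup F'] {f : X → F'} {ν : Measure X} (hf : LocallyIntegrable f ν) {k : ℝ≥0∞}
    (hk : k ≠ ∞) : LocallyIntegrable f (k • ν) := fun x => by
  obtain ⟨U, hU, hfU⟩ := hf x
  refine ⟨U, hU, ?_⟩
  rw [IntegrableOn, Measure.restrict_smul]
  exact hfU.integrable.smul_measure hk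

/-- **Local integrability is dilation invariant**: if `f` is locally integrable for a Haar
measure then so is `f (c ·)`, `c ≠ 0` (`MeasureTheory.locallyIntegrable_map_homeomorph` and
`MeasureTheory.Measure.map_addHaar_smul`). [folklore] -/
theorem locallyIntegrable_comp_smul {F' : Type*} [NormedAddCommGroup F'] {f : E → F'}
    (hf : LocallyIntegrable f μ) {c : ℝ} (hc : c ≠ 0) :
    LocallyIntegrable (fun x => f (c • x)) μ := by
  have h1 : LocallyIntegrable f (Measure.map (Homeomorph.smulOfNeZero c hc) μ) := by
    rw [show (⇑(Homeomorph.smulOfNeZero c hc) : E → E) = fun x => c • x from rfl,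
      Measure.map_addHaar_smul μ hc]
    exact locallyIntegrable_smul_measure hf ENNReal.ofReal_ne_top
  exact (locallyIntegrable_map_homeomorph (Homeomorph.smulOfNeZero c hc)).1 h1

end BMODilation

section BMOInvDilation

variable {E : Type*} [NormedAddCommGroup E] [InnerProductSpace ℝ E] [FiniteDimensional ℝ E]
  [MeasurableSpace E] [BorelSpace E]

omit [FiniteDimensional ℝ E] [MeasurableSpace E] [BorelSpace E] in
/-- Test functions on the whole space are stable under dilations `y ↦ c • y`, `c ≠ 0`
(chain rule and `HasCompactSupport.comp_homeomorph`). [folklore] -/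
theorem isTestFunctionOn_top_comp_smul {φ : E → ℝ} (hφ : FunctionSpaces.IsTestFunctionOn ⊤ φ)
    {c : ℝ} (hc : c ≠ 0) : FunctionSpaces.IsTestFunctionOn ⊤ (fun y => φ (c • y)) where
  contDiff := hφ.contDiff.comp (contDiff_const_smul c)
  hasCompactSupport := hφ.hasCompactSupport.comp_homeomorph (Homeomorph.smulOfNeZero c hc)
  tsupport_subset := fun y _ => Opens.mem_top y

omit [MeasurableSpace E] [BorelSpace E] in
/-- Chain rule for the gradient of a dilated function, in inner-product form:
`⟪w, ∇(φ(c ·))(y)⟫ = c ⟪w, (∇φ)(c y)⟫`. [folklore] -/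
theorem inner_gradient_comp_smul {φ : E → ℝ} (hφ : Differentiable ℝ φ) (c : ℝ) (y w : E) :
    ⟪w, gradient (fun y => φ (c • y)) y⟫ = c * ⟪w, gradient φ (c • y)⟫ := by
  have h2 : HasFDerivAt (fun y : E => c • y) (c • ContinuousLinearMap.id ℝ E) y :=
    (hasFDerivAt_id y).const_smul c
  have h1 : HasFDerivAt (fun y : E => φ (c • y))
      ((fderiv ℝ φ (c • y)).comp (c • ContinuousLinearMap.id ℝ E)) y :=
    (hφ (c • y)).hasFDerivAt.comp y h2
  rw [inner_gradient_right, inner_gradient_right, h1.fderiv]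
  simp

/-- **Weak divergence representations dilate**: if `u = div Φ` weakly then
`c u(c ·) = div (Φ(c ·))` weakly, `c ≠ 0`: test `c u(c ·)` against `φ` by testing `u` against
the dilated test function `φ(c⁻¹ ·)`, whose gradient is `c⁻¹ (∇φ)(c⁻¹ ·)`, and change variables
twice (`MeasureTheory.Measure.integral_comp_smul`, `MeasureTheory.Measure.integral_comp_inv_smul`);
the Jacobians `|c|^{-d}`, `|c|^{d}` and the factors `c`, `c⁻¹` cancel. This is the change of
variables behind the scale invariance of `BMO⁻¹` in its divergence form (Koch–Tataru 2001, §1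
with Theorem 1). [cite: KochTataru2001, §1] -/
theorem _root_.Literature.Analysis.FunctionSpaces.HasWeakDivergenceRepresentation.comp_smul
    {u : E → ℝ} {Φ : E → E} (h : FunctionSpaces.HasWeakDivergenceRepresentation u Φ) {c : ℝ}
    (hc : c ≠ 0) :
    FunctionSpaces.HasWeakDivergenceRepresentation (fun x => c * u (c • x)) (fun x => Φ (c • x)) where
  locallyIntegrable := (locallyIntegrable_comp_smul volume h.locallyIntegrable hc).smul c
  locallyIntegrable_field := locallyIntegrable_comp_smul volume h.locallyIntegrable_field hc
  integral_mul_eq φ hφ := by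
    have hφd : Differentiable ℝ φ := hφ.contDiff.differentiable (by simp)
    -- the dilated test function `ψ = φ (c⁻¹ ·)`, so that `φ = ψ (c ·)`
    obtain ⟨ψ, hψ_def⟩ : ∃ ψ : E → ℝ, ψ = fun y => φ (c⁻¹ • y) := ⟨_, rfl⟩
    have hψ : FunctionSpaces.IsTestFunctionOn ⊤ ψ := by
      rw [hψ_def]
      exact isTestFunctionOn_top_comp_smul hφ (inv_ne_zero hc)
    have hφψ : ∀ x, φ x = ψ (c • x) := fun x => by
      simp only [hψ_def, smul_smul, inv_mul_cancel₀ hc, one_smul]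
    -- the two integrands after the changes of variables `y = c x`
    obtain ⟨G, hG_def⟩ : ∃ G : E → ℝ, G = fun y => u y * ψ y := ⟨_, rfl⟩
    obtain ⟨H, hH_def⟩ : ∃ H : E → ℝ, H = fun x => ⟪Φ (c • x), gradient φ x⟫ := ⟨_, rfl⟩
    -- `⟪Φ, ∇ψ⟫ (y) = c⁻¹ ⟪Φ (c (c⁻¹ y)), (∇φ)(c⁻¹ y)⟫ = c⁻¹ H (c⁻¹ y)`
    have hgrad : ∀ y, ⟪Φ y, gradient ψ y⟫ = c⁻¹ * H (c⁻¹ • y) := fun y => by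
      simp only [hH_def, smul_smul, mul_inv_cancel₀ hc, one_smul]
      rw [hψ_def, inner_gradient_comp_smul hφd]
    calc ∫ x, c * u (c • x) * φ x
        = c * ∫ x, G (c • x) := by
          rw [← integral_const_mul]
          refine integral_congr_ae (Eventually.of_forall fun x => ?_)
          simp only [hG_def, hφψ x, mul_assoc]
      _ = c * (|(c ^ Module.finrank ℝ E)⁻¹| * ∫ y, u y * ψ y) := by
          rw [Measure.integral_comp_smul, smul_eq_mul, hG_def]
      _ = -(c * |(c ^ Module.finrank ℝ E)⁻¹| * ∫ y, c⁻¹ * H (c⁻¹ • y)) := by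
          rw [h.integral_mul_eq ψ hψ]
          simp_rw [hgrad]
          ring
      _ = -(c * |(c ^ Module.finrank ℝ E)⁻¹| * (c⁻¹ * (|c ^ Module.finrank ℝ E| * ∫ x, H x))) := by
          rw [integral_const_mul, Measure.integral_comp_inv_smul, smul_eq_mul]
      _ = -∫ x, ⟪Φ (c • x), gradient φ x⟫ := by
          rw [hH_def, abs_inv]
          field_simp

/-- **The vector `BMO` seminorm is dilation invariant**:
`sup_{‖v‖ ≤ 1} ‖⟪Φ(c ·), v⟫‖_* = sup_{‖v‖ ≤ 1} ‖⟪Φ, v⟫‖_*` for `c ≠ 0`. [folklore] -/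
theorem eBMOSeminormVec_comp_smul (Φ : E → E) {c : ℝ} (hc : c ≠ 0) :
    FunctionSpaces.eBMOSeminormVec (fun x => Φ (c • x)) = FunctionSpaces.eBMOSeminormVec Φ :=
  iSup_congr fun v => iSup_congr fun _ =>
    eBMOSeminorm_comp_smul volume (fun x => ⟪Φ x, v⟫) hc

/-- **Dilations do not increase the `BMO⁻¹` norm**: `‖c u(c ·)‖_{BMO⁻¹} ≤ ‖u‖_{BMO⁻¹}` for
`c ≠ 0`: every representation `u = div Φ` gives the representation `c u(c ·) = div Φ(c ·)` with
the same vector `BMO` seminorm (Koch–Tataru 2001, §1, scale invariance of `BMO⁻¹`). [cite: KochTataru2001, §1] -/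
theorem eBMOInvNorm_comp_smul_le (u : E → ℝ) {c : ℝ} (hc : c ≠ 0) :
    FunctionSpaces.eBMOInvNorm (fun x => c * u (c • x)) ≤ FunctionSpaces.eBMOInvNorm u :=
  le_iInf₂ fun Φ hΦ =>
    iInf₂_le_of_le (fun x => Φ (c • x)) (hΦ.comp_smul hc) (eBMOSeminormVec_comp_smul Φ hc).le

/-- **The `BMO⁻¹` norm is invariant under the Navier–Stokes scaling of scalars**:
`‖c u(c ·)‖_{BMO⁻¹} = ‖u‖_{BMO⁻¹}` for `c ≠ 0`, on any finite-dimensional real inner product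
space (Koch–Tataru 2001, §1: "The Navier–Stokes equations are invariant with respect to
scaling ... Hence we want a scale and translation invariant version of `L²`-boundedness", with
the divergence form of the norm, Theorem 1). [cite: KochTataru2001, §1] -/
theorem eBMOInvNorm_comp_smul (u : E → ℝ) {c : ℝ} (hc : c ≠ 0) :
    FunctionSpaces.eBMOInvNorm (fun x => c * u (c • x)) = FunctionSpaces.eBMOInvNorm u := by
  refine le_antisymm (eBMOInvNorm_comp_smul_le u hc) ?_
  have h := eBMOInvNorm_comp_smul_le (fun x => c * u (c • x)) (inv_ne_zero hc)
  have hu : (fun x => c⁻¹ * (c * u (c • c⁻¹ • x))) = u := by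
    funext x
    rw [smul_smul, mul_inv_cancel₀ hc, one_smul, ← mul_assoc, inv_mul_cancel₀ hc, one_mul]
  rwa [hu] at h

end BMOInvDilation

section RescaleHolds

/-- **Discharge of `eBMOInvNorm_rescaleData`** (`BMO⁻¹(ℝ³)` is critical; Koch–Tataru,
*Well-posedness for the Navier–Stokes equations*, Adv. Math. 157 (2001), §1, p. 2 of the held
copy `paper:doi-10-1006-aima-2000-1937`: "The Navier–Stokes equations are invariant with respect
to scaling (here one considers `u` as velocity). Hence we want a scale and translation invariant
version of `L²`-boundedness", together with the divergence characterisation of `BMO⁻¹`,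
Theorem 1, p. 3 of the held copy, which is this library's definition of the norm). For every
component, `⟪c u₀(c x), v⟫ = c ⟪u₀(c x), v⟫` (`real_inner_smul_left`) and
`eBMOInvNorm_comp_smul` applies with `c > 0`. [cite: KochTataru2001, §1] -/
theorem eBMOInvNorm_rescaleData_holds : eBMOInvNorm_rescaleData := by
  intro u₀ c hc v
  have h : (fun x => ⟪rescaleData c u₀ x, v⟫) = fun x => c * ⟪u₀ (c • x), v⟫ := by
    funext x
    rw [rescaleData_apply, real_inner_smul_left]
  rw [h]
  exact eBMOInvNorm_comp_smul (fun x => ⟪u₀ x, v⟫) hc.ne'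

end RescaleHolds

end Literature.Analysis.FluidPDE
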